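import Literature.NumberTheory.EllipticCurves.BSDSelmerParityDokchitserBaseChangeProofs
import Literature.NumberTheory.EllipticCurves.PAdicBSDKatoFiniteProofs
import Literature.NumberTheory.EllipticCurves.ComplexMultiplicationBurungaleFlachFiniteThreeLeavesProofs
import HarnessLib

/-!
# Burungale–Flach 2024, the finiteness half (Prop. 4.1) below Kato's finiteness theorem alone

Sibling *proofs* file (theorems only: no definition, no named fact, no instance) for the named
fact `Literature.NumberTheory.EllipticCurves.BurungaleFlach2024_finite_primary_cmField`
(`ComplexMultiplicationBurungaleFlachPrimaryProofs.lean`; A. Burungale, M. Flach, Camb. J. Math.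
12 (2024), arXiv:2206.09874, Prop. 4.1 (arXiv p. 19) as used in the proof of Thm. 1.1 (p. 22):
for `E/ℚ` with `j(E) ∈ maximalCMJInvariants` and `L(E/ℚ, 1) ≠ 0`, `K` its CM field and `W'` a
globally minimal model of `E_K`, the groups `E(K)` and `Ш(E_K/K)[p^∞]` are finite for every
rational prime `p`; Remark 10: classically Coates–Wiles 1977 / Arthaud 1978 / Rubin 1981 for
`E(K)` and Rubin 1987 for `Ш`).

## What is proved

So far the fact rested, sorry-free, on the two `𝔭`-adic theories of complex multiplication
(`BurungaleFlach2024_finite_primary_cmField_of_two_leaves`,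
`ComplexMultiplicationBurungaleFlachCorOneThreeLeavesProofs.lean`): the `𝔭`-divisibility of
`Ω⁻¹ L(E/ℚ, 1)` of Coates–Wiles 1977, §6 (`CoatesWiles1977_L_one_div_period_mem_prime`) for
`E(K)`, and Rubin 1987, §10 (`Rubin1987_sha_primary_finite`) for `Ш(E_K/K)[p^∞]`. This file
puts the whole fact below the **single** central rank-zero leaf of the BSD cone instead:

* `BurungaleFlach2024_finite_primary_cmField_of_Kato` (**proved**): the fact follows from
  Kato's finiteness theorem bsd.S20 in the tree's form `kato_finite_of_L_one_ne_zero`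
  (K. Kato, Astérisque 295 (2004), Thm. 14.2 (2) and Cor. 14.3: `L(E, 1) ≠ 0 ⇒ E(ℚ)`,
  `Ш(E/ℚ)[p^∞]` and `Sel_{p^∞}(E/ℚ)` finite, for every elliptic `E/ℚ` and every prime `p`);
* `BurungaleFlach2024_finite_primary_cmField_of_GrossZagierKolyvagin` (**proved**): hence also
  from bsd.S17 alone (`rank_eq_analyticRank_of_analyticRank_le_one`, Gross–Zagier–Kolyvagin,
  through the tree's `kato_finite_of_L_one_ne_zero_of_rank_eq_analyticRank`).

Since Coates–Wiles' Theorem 1 is itself below Kato's theorem in the tree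
(`CoatesWiles1977_L_one_div_period_mem_prime_of_Kato`), the net effect on the census of the
fact is `{Coates–Wiles §6, Rubin §10} ↦ {Kato Cor. 14.3}` (or `{bsd.S17}`): the finiteness half of
bsd.S28 no longer carries any debt of its own beyond the rank-zero leaf shared by the whole
cone. The discharge `BurungaleFlach2024_finite_primary_cmField_holds` is the one-liner
`…_of_Kato (fun W _ p _ ↦ kato_finite_of_L_one_ne_zero_holds W p)` as soon as bsd.S20 (or
bsd.S17) is discharged; it is **not** asserted here.

## The argument (Kato's Cor. 14.3 for a quadratic field, from its instance `K = ℚ`, `χ = 1`)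

Kato prints Cor. 14.3 for every finite abelian `K/ℚ` and every character `χ` of `Gal(K/ℚ)`
(p. 235: *"assume `L(A, χ, 1) ≠ 0`. Then: (1) The `χ`-part `Sel(K, A ⊗ K)^{(χ)}` … is finite.
(2) The `χ`-part of `A(K)` is finite"*); the tree vendors the instance `A = E`, `K = ℚ`,
`χ = 1`. For a quadratic field `K = ℚ(θ)`, `θ² = c`, the case of both characters is recovered
here from that instance applied to `E` and to the twist `E^{(c)}` by the **quadratic descent of
`p^∞`-Selmer groups**, entirely proved in the tree
(`BSDSelmerParityDokchitserBaseChangeProofs.lean`, after T. Dokchitser–V. Dokchitser, Ann. of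
Math. 172 (2010), proof of Lemma 4.14, and T. Dokchitser, *Notes on the parity conjecture*
(2013), §4): the comparison map
`Φ : Sel_{p^∞}(E/ℚ) × Sel_{p^∞}(E^{(c)}/ℚ) → Sel_{p^∞}(E/K)`, `(η, η') ↦ res η + ψ_*(res η')`
(`comparisonMap`) has cokernel killed by `8` (`nsmul_mem_range_comparisonMap`). Hence:

* `finite_of_finite_of_nsmul_mem_range` (algebra): a `p`-primary group with finite `p`-torsion
  receiving a homomorphism from a finite group with cokernel killed by some `N ≠ 0` is finite;
* `finite_selmerGroupPInfty_baseChange_of_finite`: `Sel_{p^∞}(E/ℚ)` and `Sel_{p^∞}(E^{(c)}/ℚ)`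
  finite `⇒ Sel_{p^∞}(E/K)` finite (`Sel_{p^∞}(E/K)` is `p`-primary with finite `p`-torsion:
  `exists_pow_nsmul_eq_zero_galH1Primary`, `finite_torsionBy_selmerGroupPInfty`, the latter by
  the finiteness of the `p`-Selmer group, Silverman X.4.2 (b), proved in the tree);
* `finite_point_and_primaryComponent_sha_baseChange_of_finite`: `E(ℚ)`, `Ш(E/ℚ)[p^∞]`,
  `E^{(c)}(ℚ)`, `Ш(E^{(c)}/ℚ)[p^∞]` finite `⇒ E(K)` and `Ш(E_K/K)[p^∞]` finite, through
  `0 → E(F) ⊗ ℚ_p/ℤ_p → Sel_{p^∞}(E/F) → Ш(E/F)[p^∞] → 0` over `F = ℚ` and `F = K`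
  (`WeierstrassCurve.finite_selmerGroupPInfty_iff`, Greenberg 1999 §1, proved in the tree with
  the Mordell–Weil theorem);
* `kato_finite_baseChange_quadratic`: Kato's theorem over `ℚ` `⇒` for `E/ℚ`, `K = ℚ(√c)`
  quadratic with `L(E, 1) ≠ 0` and `L(E^{(c)}, 1) ≠ 0`: `E(K)`, `Ш(E_K/K)[p^∞]` and
  `Sel_{p^∞}(E_K/K)` are finite for every prime `p` — Cor. 14.3 for quadratic `K`;
* the CM case: for `j(E) ∈ maximalCMJInvariants` the twist `E^{(d_K)}` by the CM discriminant is
  `ℚ`-isogenous to `E` (`isIsogenous_quadraticTwist_cmFieldDiscr_holds`), so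
  `L(E^{(d_K)}, 1) = L(E, 1) ≠ 0` (Faltings / Knapp 11.67, `entireLFunction_eq_of_isIsogenous'`,
  a theorem of the tree), `K = ℚ(√d_K)` (`IsCMFieldOfJ.exists_sqrt`), and both conclusions are
  transported to the globally minimal model `W' = C • E_K`
  (`VariableChange.pointEquiv`, `finite_sha_primary_variableChange_iff`).

`open WeierstrassCurve` is issued at file scope, before the `Literature` namespace is entered
(shadowing hazard recorded in `…FiniteThreeLeavesProofs.lean`, Design).

## References

* A. Burungale, M. Flach, *The conjecture of Birch and Swinnerton-Dyer for certain elliptic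
  curves with complex multiplication*, Camb. J. Math. 12 (2024) = arXiv:2206.09874: Prop. 4.1
  and Remark 10 (arXiv p. 19), proof of Thm. 1.1 (p. 22). [BurungaleFlach2024]
* K. Kato, *`p`-adic Hodge theory and values of zeta functions of modular forms*, Astérisque 295
  (2004): Thm. 14.2 (2), Cor. 14.3 (p. 235). [Kato2004Asterisque]
* T. Dokchitser, V. Dokchitser, *On the Birch–Swinnerton-Dyer quotients modulo squares*,
  Ann. of Math. 172 (2010), Lemma 4.14 (proof). [DokchitserDokchitserAnnals2010]
* T. Dokchitser, *Notes on the parity conjecture*, CRM Barcelona (2013) = arXiv:1009.5389, §4.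
  [Dokchitser2013ParityNotes]
* R. Greenberg, *Iwasawa theory for elliptic curves*, LNM 1716 (1999), §1 (pp. 54–57), §2.
  [Greenberg1999LNM]
* H. Darmon, *Rational points on modular elliptic curves*, CBMS 101 (2004), Thm. 3.22. [Darmon2004]
-/

noncomputable section

open scoped Classical AddSubgroup

open WeierstrassCurve

namespace Literature.NumberTheory.EllipticCurves

/-! ### Algebra: a `p`-primary group under a finite group up to bounded cokernel is finite -/

/-- **Finiteness through a map with bounded cokernel.** Let `f : A → B` be a homomorphism of
abelian groups with `A` finite, `B` `p`-primary with finite `p`-torsion, and `N • B ⊆ im f` for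
some `N ≠ 0`. Then `B` is finite: multiplication by `N` on `B` has kernel `B[N]`, finite
(`finite_torsionBy_of_primary`), and image inside the finite `im f`. (The finiteness shadow of
the quasi-isomorphism invariance of the corank, `zpCorank_eq_of_nsmul_ker_of_nsmul_coker`.)
[folklore] -/
theorem finite_of_finite_of_nsmul_mem_range {A B : Type*} [AddCommGroup A] [AddCommGroup B]
    {p : ℕ} (hp : p.Prime) (f : A →+ B) [Finite A] (hB : ∀ b : B, ∃ n : ℕ, p ^ n • b = 0)
    [Finite B[(p : ℤ)]] {N : ℕ} (hN : N ≠ 0) (hcoker : ∀ b : B, N • b ∈ f.range) :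
    Finite B := by
  rw [(nsmulAddMonoidHom N : B →+ B).finite_iff_finite_ker_range]
  constructor
  · -- the kernel of `N •` is `B[N]`, finite
    haveI := finite_torsionBy_of_primary B hp hB hN
    refine Finite.of_injective
      (fun x : (nsmulAddMonoidHom N : B →+ B).ker ↦ (⟨(x : B), ?_⟩ : B[(N : ℤ)])) ?_
    · have hx : N • (x : B) = 0 := by
        have h := (AddMonoidHom.mem_ker).mp x.2
        rwa [nsmulAddMonoidHom_apply] at h
      exact AddSubgroup.torsionBy.nsmul_iff.mpr hx
    · intro x y hxy
      exact Subtype.ext (congrArg (fun z : B[(N : ℤ)] ↦ (z : B)) hxy)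
  · -- the image of `N •` lies in the finite image of `f`
    haveI : Finite f.range := Finite.of_surjective _ f.rangeRestrict_surjective
    refine Finite.of_injective
      (fun y : (nsmulAddMonoidHom N : B →+ B).range ↦ (⟨(y : B), ?_⟩ : f.range)) ?_
    · obtain ⟨b, hb⟩ := y.2
      rw [← hb, nsmulAddMonoidHom_apply]
      exact hcoker b
    · intro x y hxy
      exact Subtype.ext (congrArg (fun z : f.range ↦ (z : B)) hxy)

/-! ### Quadratic descent of finiteness: `Sel_{p^∞}`, `E(K)` and `Ш[p^∞]` over `K = ℚ(√c)` -/

section Quadratic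

variable (W : WeierstrassCurve ℚ) [W.IsElliptic] (K : Type) [Field K] [NumberField K]
  (h2 : Module.finrank ℚ K = 2) {θ : K} {c : ℚ} (hθ : θ ∉ Set.range (algebraMap ℚ K))
  (hc : θ ^ 2 = algebraMap ℚ K c) (p : ℕ) [Fact p.Prime]

include hθ hc in
/-- `c ≠ 0` when `θ² = c` and `θ ∉ ℚ`. [folklore] -/
theorem ne_zero_of_sq_eq_of_not_mem_range : c ≠ 0 := by
  rintro rfl
  apply QuadraticFields.Quadratic.ne_zero_of_not_mem_range hθ
  have h : θ ^ 2 = 0 := by rw [hc, map_zero]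
  exact pow_eq_zero_iff (n := 2) (by norm_num) |>.mp h

include h2 hθ hc in
/-- **`Sel_{p^∞}(E/ℚ)` and `Sel_{p^∞}(E^{(c)}/ℚ)` finite `⇒ Sel_{p^∞}(E/K)` finite**, for
`K = ℚ(θ)`, `θ² = c`, and every prime `p`: the comparison map
`Sel_{p^∞}(E/ℚ) × Sel_{p^∞}(E^{(c)}/ℚ) → Sel_{p^∞}(E/K)` of the quadratic descent
(`comparisonMap`; Dokchitser–Dokchitser 2010, proof of Lemma 4.14 with the twist) has cokernel
killed by `8` (`nsmul_mem_range_comparisonMap`), and `Sel_{p^∞}(E/K)` is `p`-primary with finite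
`p`-torsion. [cite: DokchitserDokchitserAnnals2010, Lemma 4.14 (proof)]
[cite: Dokchitser2013ParityNotes, §4 (`X_p(E/F) = X⁺ ⊕ X⁻`)] -/
theorem finite_selmerGroupPInfty_baseChange_of_finite [Finite (W.selmerGroupPInfty p)]
    [Finite ((W.quadraticTwist c).selmerGroupPInfty p)] :
    Finite ((W.baseChange K).selmerGroupPInfty p) := by
  haveI : (W.baseChange K).IsElliptic := by rw [baseChange]; infer_instance
  haveI : Finite ((W.baseChange K).selmerGroupPInfty p)[(p : ℤ)] :=
    finite_torsionBy_selmerGroupPInfty (W.baseChange K) p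
  have hSK : ∀ x : (W.baseChange K).selmerGroupPInfty p, ∃ k : ℕ, p ^ k • x = 0 := fun x ↦ by
    obtain ⟨k, hk⟩ := exists_pow_nsmul_eq_zero_galH1Primary (W.baseChange K) p
      (x : galH1Primary (W.baseChange K) p)
    exact ⟨k, Subtype.ext (by rw [AddSubmonoidClass.coe_nsmul, hk, ZeroMemClass.coe_zero])⟩
  exact finite_of_finite_of_nsmul_mem_range (Fact.out : p.Prime) (comparisonMap W K hθ hc p) hSK
    (N := 8) (by norm_num) (nsmul_mem_range_comparisonMap W K h2 hθ hc p)

include h2 hθ hc in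
/-- **Quadratic descent of the finiteness of `E(·)` and `Ш[p^∞]`.** For `E/ℚ`, `K = ℚ(θ)` with
`θ² = c`, and a prime `p`: if `E(ℚ)`, `Ш(E/ℚ)[p^∞]`, `E^{(c)}(ℚ)` and `Ш(E^{(c)}/ℚ)[p^∞]` are
finite then `E(K)` and `Ш(E_K/K)[p^∞]` are finite. Through the exact sequences
`0 → E(F) ⊗ ℚ_p/ℤ_p → Sel_{p^∞}(E/F) → Ш(E/F)[p^∞] → 0` for `F = ℚ, K`
(`WeierstrassCurve.finite_selmerGroupPInfty_iff`, Greenberg 1999, §1) and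
`finite_selmerGroupPInfty_baseChange_of_finite`.
[cite: DokchitserDokchitserAnnals2010, Lemma 4.14 (proof)] [cite: Greenberg1999LNM, §1 pp. 54–57] -/
theorem finite_point_and_primaryComponent_sha_baseChange_of_finite
    (hE : Finite W.toAffine.Point) (hS : Finite (AddCommGroup.primaryComponent W.sha p))
    (hE' : Finite (W.quadraticTwist c).toAffine.Point)
    (hS' : Finite (AddCommGroup.primaryComponent (W.quadraticTwist c).sha p)) :
    Finite (W.baseChange K).toAffine.Point ∧
      Finite (AddCommGroup.primaryComponent (W.baseChange K).sha p) := by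
  haveI : (W.quadraticTwist c).IsElliptic :=
    W.isElliptic_quadraticTwist (ne_zero_of_sq_eq_of_not_mem_range K hθ hc)
  haveI : (W.baseChange K).IsElliptic := by rw [baseChange]; infer_instance
  haveI : Finite (W.selmerGroupPInfty p) := (W.finite_selmerGroupPInfty_iff p).mpr ⟨hE, hS⟩
  haveI : Finite ((W.quadraticTwist c).selmerGroupPInfty p) :=
    ((W.quadraticTwist c).finite_selmerGroupPInfty_iff p).mpr ⟨hE', hS'⟩
  exact ((W.baseChange K).finite_selmerGroupPInfty_iff p).mp
    (finite_selmerGroupPInfty_baseChange_of_finite W K h2 hθ hc p)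

omit [W.IsElliptic] [Fact p.Prime] in
include h2 hθ hc in
/-- **Kato's Cor. 14.3 over a quadratic field, from its instance `K = ℚ`, `χ = 1`.** Assume
Kato's finiteness theorem in the tree's form (`h`: for every elliptic `E/ℚ` and prime `p`,
`L(E, 1) ≠ 0 ⇒ E(ℚ)`, `Ш(E/ℚ)[p^∞]`, `Sel_{p^∞}(E/ℚ)` finite; Kato, Astérisque 295, Cor. 14.3
with `K = ℚ`, `χ = 1`). Then for `E/ℚ`, a quadratic field `K = ℚ(θ)`, `θ² = c`, with
`L(E, 1) ≠ 0` and `L(E^{(c)}, 1) ≠ 0`, and every prime `p`: `E(K)`, `Ш(E_K/K)[p^∞]` and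
`Sel_{p^∞}(E_K/K)` are finite — the conclusion of Cor. 14.3 (both parts, both characters of
`Gal(K/ℚ)`) for `A = E` and the quadratic field `K` (printed for any finite abelian `K/ℚ` and
character `χ` with `L(A, χ, 1) ≠ 0`: *"(1) The `χ`-part `Sel(K, A ⊗ K)^{(χ)}` … is finite.
(2) The `χ`-part of `A(K)` is finite"*), obtained by the quadratic descent of Selmer groups.
[cite: Kato2004Asterisque, Cor. 14.3 (p. 235)] [cite: DokchitserDokchitserAnnals2010, Lemma 4.14 (proof)] -/
theorem kato_finite_baseChange_quadratic
    (h : ∀ (W : WeierstrassCurve ℚ) [W.IsElliptic] (p : ℕ) [Fact p.Prime],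
      kato_finite_of_L_one_ne_zero W p)
    [W.IsElliptic] [Fact p.Prime] (hL : W.entireLFunction 1 ≠ 0)
    (hL' : (W.quadraticTwist c).entireLFunction 1 ≠ 0) :
    Finite (W.baseChange K).toAffine.Point ∧
      Finite (AddCommGroup.primaryComponent (W.baseChange K).sha p) ∧
        Finite ((W.baseChange K).selmerGroupPInfty p) := by
  haveI : (W.quadraticTwist c).IsElliptic :=
    W.isElliptic_quadraticTwist (ne_zero_of_sq_eq_of_not_mem_range K hθ hc)
  haveI : (W.baseChange K).IsElliptic := by rw [baseChange]; infer_instance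
  haveI : Finite (W.selmerGroupPInfty p) := (h W p hL).2.2
  haveI : Finite ((W.quadraticTwist c).selmerGroupPInfty p) := (h (W.quadraticTwist c) p hL').2.2
  have hSK : Finite ((W.baseChange K).selmerGroupPInfty p) :=
    finite_selmerGroupPInfty_baseChange_of_finite W K h2 hθ hc p
  obtain ⟨hpt, hsha⟩ := ((W.baseChange K).finite_selmerGroupPInfty_iff p).mp hSK
  exact ⟨hpt, hsha, hSK⟩

end Quadratic

/-! ### The finiteness half of Burungale–Flach's Theorem 1.1 below Kato / Gross–Zagier–Kolyvagin -/

/-- **Burungale–Flach 2024, Prop. 4.1 at `F = K` (the finiteness half of Thm. 1.1), from Kato's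
finiteness theorem alone.** For `E/ℚ` with `j(E) ∈ maximalCMJInvariants` and `L(E/ℚ, 1) ≠ 0`,
`K` its CM field and `W' = C • E_K` a globally minimal model: `E(K) = W'(K)` and `Ш(W'/K)[p^∞]`
are finite for every rational prime `p` — assuming only `kato_finite_of_L_one_ne_zero` for all
elliptic curves over `ℚ` and all primes (`h`; Kato, Astérisque 295, Cor. 14.3). Proof:
`K = ℚ(θ)` with `θ² = d_K` (`IsCMFieldOfJ.exists_sqrt`); the twist `E^{(d_K)}` is `ℚ`-isogenous
to `E` (`isIsogenous_quadraticTwist_cmFieldDiscr_holds`), so `L(E^{(d_K)}, 1) = L(E, 1) ≠ 0`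
(`entireLFunction_eq_of_isIsogenous'`); `kato_finite_baseChange_quadratic` gives the finiteness
of `E(K)` and `Ш(E_K/K)[p^∞]`, transported to `W'` (`VariableChange.pointEquiv`,
`finite_sha_primary_variableChange_iff`). Compared with
`BurungaleFlach2024_finite_primary_cmField_of_two_leaves` (Coates–Wiles 1977 §6 and Rubin 1987
§10, the sources of Remark 10 of the paper), the fact here rests on the single rank-zero leaf
bsd.S20 of the cone, below which Coates–Wiles' Theorem 1 already sits
(`CoatesWiles1977_L_one_div_period_mem_prime_of_Kato`).
[cite: BurungaleFlach2024, Prop. 4.1 with Remark 10 (arXiv p. 19), proof of Thm. 1.1 (p. 22)]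
[cite: Kato2004Asterisque, Cor. 14.3 (p. 235)] [cite: DokchitserDokchitserAnnals2010, Lemma 4.14 (proof)] -/
theorem BurungaleFlach2024_finite_primary_cmField_of_Kato
    (h : ∀ (W : WeierstrassCurve ℚ) [W.IsElliptic] (p : ℕ) [Fact p.Prime],
      kato_finite_of_L_one_ne_zero W p) :
    BurungaleFlach2024_finite_primary_cmField := by
  intro W _ hj hL K _ _ hK W' _ _ hW' p hp
  haveI : Fact p.Prime := ⟨hp⟩
  obtain ⟨C, rfl⟩ := hW'
  -- `K = ℚ(θ)`, `θ² = d_K`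
  obtain ⟨θ, hθ, hc⟩ := hK.exists_sqrt hj
  have hd0 : (cmFieldDiscr W.j : ℚ) ≠ 0 := ne_zero_of_sq_eq_of_not_mem_range K hθ hc
  haveI : (W.quadraticTwist (cmFieldDiscr W.j : ℚ)).IsElliptic := W.isElliptic_quadraticTwist hd0
  -- `L(E^{(d_K)}, 1) = L(E, 1) ≠ 0` along the CM twist isogeny
  have hLd : (W.quadraticTwist (cmFieldDiscr W.j : ℚ)).entireLFunction 1 ≠ 0 := by
    rw [← entireLFunction_eq_of_isIsogenous' (isIsogenous_quadraticTwist_cmFieldDiscr_holds W hj)]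
    exact hL
  -- Kato over the quadratic field `K`
  obtain ⟨hpt, hsha, -⟩ := kato_finite_baseChange_quadratic W K hK.1 hθ hc p h hL hLd
  refine ⟨Finite.of_equiv _ (VariableChange.pointEquiv (W.baseChange K) C).toEquiv, ?_⟩
  rw [(W.baseChange K).finite_sha_primary_variableChange_iff C p, ← coe_primaryComponent]
  exact Set.finite_coe_iff.mp hsha

/-- **The finiteness half of Burungale–Flach's Theorem 1.1 at `F = K` from
Gross–Zagier–Kolyvagin (bsd.S17) alone**: `rank_eq_analyticRank_of_analyticRank_le_one` (`h`;
Darmon, CBMS 101, Thm. 3.22: `ord_{s=1} L(E,s) ≤ 1 ⇒ rank E(ℚ) = ord_{s=1} L(E,s)` and `Ш(E/ℚ)`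
finite) implies Kato's finiteness statement for every elliptic `E/ℚ` and prime `p`
(`kato_finite_of_L_one_ne_zero_of_rank_eq_analyticRank`, a theorem of the tree), whence the fact
by `BurungaleFlach2024_finite_primary_cmField_of_Kato`.
[cite: BurungaleFlach2024, Prop. 4.1 with Remark 10 (arXiv p. 19)] [cite: Darmon2004, Thm. 3.22]
[cite: Kato2004Asterisque, Cor. 14.3 (p. 235)] -/
theorem BurungaleFlach2024_finite_primary_cmField_of_GrossZagierKolyvagin
    (h : rank_eq_analyticRank_of_analyticRank_le_one) :
    BurungaleFlach2024_finite_primary_cmField :=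
  BurungaleFlach2024_finite_primary_cmField_of_Kato fun W _ p _ ↦
    kato_finite_of_L_one_ne_zero_of_rank_eq_analyticRank W p h

end Literature.NumberTheory.EllipticCurves
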